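import Literature.Probability.RandomPlanarGeometry.BrownianExcursionRestriction
import HarnessLib

/-!
# Discharge of `exists_isRightRestrictionMeasure_lt_five_eighths` (and of Prop. 8.1 existence, Cor. 8.6)

Proof-only sibling of `OneSidedRestriction` (no definition, no named fact), after

* G. F. Lawler, O. Schramm, W. Werner, *Conformal restriction: the chordal case*, J. Amer. Math.
  Soc. **16** (2003) 917–955, arXiv:math/0209343 (**[LSW]**), Cor. 8.6 (pp. 37–38) with
  Prop. 8.1 (§8.2) and §4 Prop. 4.1 (p. 16);
* G. F. Lawler, *Conformal restriction and related questions*, AMS (2005) (**[Law05]**),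
  Cor. 9.11 (p. 219) with §9.2 Prop. 9.13 (p. 220).

The named fact `exists_isRightRestrictionMeasure_lt_five_eighths` (`OneSidedRestriction`: for
`0 < α < 5/8` the right-sided restriction measure `P⁺_α` exists and `P⁺_α{i ∉ K} > 1/2`) was
reduced in the tree to the existence of SOME two-sided restriction measure of exponent `1`
(`exists_isRightRestrictionMeasure_lt_five_eighths_of_exists_one`,
`OneSidedExcursionCloudInterior`: existence of all `P⁺_β` by the hung Poissonian cloud of [Law05]
§9.2, positivity `P⁺_β{i ∈ K} > 0` by hanging a `P_1`-sample with an interior point, and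
`q(5/8) = 1/2`). The two-sided measure `P_1` now exists unconditionally: it is the law of the
filling of the Brownian excursion `W⁰ + i|w|` of a four-dimensional Brownian motion
(`exists_isRestrictionMeasure_one_brownianQuad`, `BrownianExcursionRestriction`, i.e. [LSW]
Prop. 4.1 proved). Contents, everything PROVED:

* `exists_isRightRestrictionMeasure_lt_five_eighths_holds` — the discharge;
* `exists_isRightRestrictionMeasure_holds` — [LSW] Prop. 8.1, first sentence: `P⁺_α` exists for
  every `α > 0` (`ExcursionCloud.exists_isRightRestrictionMeasure_of_exists_one`: the left-filled
  hung cloud of intensity `αν` built on `P_1`, [Law05] Prop. 9.13);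
* `not_exists_isRestrictionMeasure_of_lt_five_eighths_holds` — [LSW] Cor. 8.6: `P_α` does not
  exist for `α < 5/8` (`not_exists_isRestrictionMeasure_of_lt_five_eighths_of_exists_one`).

## References

* [LSW] Cor. 8.6 (pp. 37–38), Prop. 8.1 (§8.2), Prop. 4.1 (p. 16).
  [LawlerSchrammWerner2003Restriction]
* [Law05] Cor. 9.11 (p. 219), Prop. 9.13 (p. 220). [Lawler2005]
-/

noncomputable section

namespace Literature.Probability.RandomPlanarGeometry

/-- **Discharge of `exists_isRightRestrictionMeasure_lt_five_eighths`**: for `0 < α < 5/8` the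
right-sided restriction measure `P⁺_α` exists and `P⁺_α{i ∉ K} > 1/2` — from the two-sided
`P_1` of the Brownian excursion ([LSW] Prop. 4.1) through the tree's reduction
`exists_isRightRestrictionMeasure_lt_five_eighths_of_exists_one` ([Law05] Cor. 9.11 with
Prop. 9.13). [cite: Lawler2005, Cor. 9.11 (p. 219) with §9.2 Prop. 9.13 (p. 220); LawlerSchrammWerner2003Restriction, Cor. 8.6 (pp. 37–38) and Prop. 4.1 (p. 16)] -/
theorem exists_isRightRestrictionMeasure_lt_five_eighths_holds :
    exists_isRightRestrictionMeasure_lt_five_eighths :=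
  exists_isRightRestrictionMeasure_lt_five_eighths_of_exists_one
    exists_isRestrictionMeasure_one_brownianQuad

/-- **Discharge of `exists_isRightRestrictionMeasure`** ([LSW] Prop. 8.1, first sentence: "The
right-sided restriction measures `P⁺_α` exist for all `α > 0`"), realised as in [Law05] §9.2 by
the left-filled Poissonian cloud of hung `P_1`-samples
(`ExcursionCloud.exists_isRightRestrictionMeasure_of_exists_one`), `P_1` being the filled
Brownian excursion. [cite: LawlerSchrammWerner2003Restriction, Prop. 8.1 (§8.2); Lawler2005, §9.2 Prop. 9.13 (p. 220)] -/
theorem exists_isRightRestrictionMeasure_holds : exists_isRightRestrictionMeasure :=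
  fun _ hα ↦ ExcursionCloud.exists_isRightRestrictionMeasure_of_exists_one
    exists_isRestrictionMeasure_one_brownianQuad hα

/-- **Discharge of `not_exists_isRestrictionMeasure_of_lt_five_eighths`** ([LSW] Cor. 8.6:
"`P_α` does not exist for `α < 5/8`"; [Law05] Cor. 9.11), from `P_1`
(`not_exists_isRestrictionMeasure_of_lt_five_eighths_of_exists_one`).
[cite: LawlerSchrammWerner2003Restriction, Cor. 8.6 (pp. 37–38); Lawler2005, Cor. 9.11 (p. 219)] -/
theorem not_exists_isRestrictionMeasure_of_lt_five_eighths_holds :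
    not_exists_isRestrictionMeasure_of_lt_five_eighths :=
  not_exists_isRestrictionMeasure_of_lt_five_eighths_of_exists_one
    exists_isRestrictionMeasure_one_brownianQuad

end Literature.Probability.RandomPlanarGeometry

end
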